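import Literature.Probability.RandomPlanarGeometry.HexParafermion
import Literature.Probability.RandomPlanarGeometry.HexSAWHopfPath
import HarnessLib

/-!
# Transport between the honeycomb lattice `hexGraph` and its coordinate model `HV`

Topic `Literature/Probability/RandomPlanarGeometry`; second support file for the discharge of the
named fact `Literature.Probability.RandomPlanarGeometry.SAW.DuminilCopinSmirnov2012_lemma1`
(`HexParafermion.lean`), whose statement lives on `hexGraph` (vertices `HexVertex`, embedded by
`hexCenter`, windings measured geometrically by `Literature.Probability.LatticeModels.winding`),
while the combinatorial proof of the vertex relation (`HexSAWObservable.lean`,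
`HexParafermionLoop.lean`) lives in the coordinate model `HV` with the entrance mid-edge fixed at
`{wOut, hvOrigin}` and windings counted as `(π/3) · pturn`. Source: H. Duminil-Copin, S. Smirnov,
*The connective constant of the honeycomb lattice equals `√(2+√2)`*, Ann. of Math. 175 (2012),
1653–1665 (arXiv:1007.0575), §2 ("we define its winding `W_γ(a,b)` as the total rotation of the
direction in radians when `γ` is traversed from `a` to `b`").

## Contents (namespace `Literature.Probability.RandomPlanarGeometry.SAW.HV`)

* `emb_pos_shift`, `emb_pos_flip`, `emb_pos_toHV`: the translations, the central flip and the
  coordinate map act on embedded positions `emb ∘ pos` by complex-affine maps (`3 · hexCenter`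
  for `toHV`).
* **`exists_chart`**: for every dart `u → w` of `hexGraph` there is a graph isomorphism
  `Φ : hexGraph ≃g hvGraph` with `Φ u = wOut`, `Φ w = hvOrigin` and
  `emb (pos (Φ f)) = α · hexCenter f + β` for some `α ≠ 0` (dart transitivity of the honeycomb
  lattice by orientation-preserving similarities: translations, the central flip, and the
  rotation by `2π/3` about `hvOrigin`, `(x₀, x₁, b) ↦ (-x₀ - x₁ - [b], x₀, b)`, built inside the
  proof).
* `turning_affine`, `turning_emb_pos`, **`winding_map_emb_pos`**: the geometric winding of an
  embedded lattice path without backtracking is `(π/3) · pturn`.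
-/

noncomputable section

open Finset Literature.Probability.LatticeModels Literature.Probability.Percolation

namespace Literature.Probability.RandomPlanarGeometry.SAW

namespace HV

/-! ### Embedded positions under the automorphisms and the coordinate map -/

/-- `emb (a, b) = a + b ω`. [folklore] -/
theorem emb_mk (a b : ℤ) : emb (a, b) = (a : ℂ) + (b : ℂ) * omg := rfl

/-- Translations act on embedded positions by translations. [folklore] -/
theorem emb_pos_shift (a b : ℤ) (v : HV) :
    emb (pos (shift a b v)) = 1 * emb (pos v) + emb (3 * a, 3 * b) := by
  rw [← tr_eq_shift (a, b) v, pos_tr, emb_add, one_mul]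

/-- The central flip acts on embedded positions by `z ↦ -z + 3`. [folklore] -/
theorem emb_pos_flip (v : HV) : emb (pos (flip v)) = (-1) * emb (pos v) + emb (3, 0) := by
  obtain ⟨a, b, c⟩ := v
  cases c <;> simp [pos, emb_mk] <;> ring

/-- `ζ = e^{iπ/3}` of `TriangularLattice` is `ω` of `HexSAWObservable`. [folklore] -/
theorem triZeta_eq_omg : triZeta = omg := by
  unfold triZeta omg
  congr 1
  push_cast
  ring

/-- **The coordinate model is the honeycomb lattice scaled by `3`**: `emb (pos (toHV f)) =
3 · hexCenter f`. [folklore] -/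
theorem emb_pos_toHV (f : HexVertex) : emb (pos (toHV f)) = 3 * hexCenter f + 0 := by
  obtain ⟨x, i⟩ := f
  rw [add_zero, hexCenter, triEmbed, triZeta_eq_omg]
  fin_cases i
  · simp [toHV, pos, emb_mk]
    ring
  · simp [toHV, pos, emb_mk]
    ring

/-- Composition of an affine chart with an affine automorphism is an affine chart. [folklore] -/
theorem chart_trans {Φ : hexGraph ≃g hvGraph} {α β : ℂ}
    (hΦ : ∀ f, emb (pos (Φ f)) = α * hexCenter f + β) (ψ : hvGraph ≃g hvGraph) {κ : ℂ}
    {c : ℤ × ℤ} (hψ : ∀ v, emb (pos (ψ v)) = κ * emb (pos v) + emb c) (f : HexVertex) :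
    emb (pos ((Φ.trans ψ) f)) = (κ * α) * hexCenter f + (κ * β + emb c) := by
  rw [RelIso.trans_apply, hψ, hΦ]
  ring

/-- **Dart transitivity by similarities**: every dart `u → w` of the honeycomb lattice is mapped
to the standard entrance dart `wOut → hvOrigin` of the coordinate model by a graph isomorphism
`hexGraph ≃g hvGraph` acting on the embedded lattice by a complex-affine map `z ↦ α z + β`,
`α ≠ 0` (a translation, possibly the central flip, and a rotation by a multiple of `2π/3`).
[folklore] -/
theorem exists_chart {u w : HexVertex} (h : hexGraph.Adj u w) :
    ∃ (Φ : hexGraph ≃g hvGraph) (α β : ℂ), α ≠ 0 ∧ Φ u = wOut ∧ Φ w = hvOrigin ∧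
      ∀ f, emb (pos (Φ f)) = α * hexCenter f + β := by
  -- Step 1: the coordinate map followed by `toOrigin (toHV w)`
  have h0 : ∀ f, emb (pos (hvIso f)) = 3 * hexCenter f + 0 := emb_pos_toHV
  set Φ₁ : hexGraph ≃g hvGraph := hvIso.trans (toOrigin (toHV w)) with hΦ₁
  have h1 : ∃ α β : ℂ, α ≠ 0 ∧ ∀ f, emb (pos (Φ₁ f)) = α * hexCenter f + β := by
    by_cases hb : (toHV w).2.2 = true
    · refine ⟨1 * ((-1) * 3),
        1 * ((-1) * 0 + emb (3, 0)) + emb (3 * (toHV w).1, 3 * ((toHV w).2.1 + 1)),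
        by norm_num, fun f => ?_⟩
      have e : Φ₁ = (hvIso.trans flip).trans (shift (toHV w).1 ((toHV w).2.1 + 1)) := by
        rw [hΦ₁, toOrigin, if_pos hb]; rfl
      rw [e]
      exact chart_trans (chart_trans h0 flip emb_pos_flip) (shift _ _) (emb_pos_shift _ _) f
    · refine ⟨1 * 3, 1 * 0 + emb (3 * -(toHV w).1, 3 * -(toHV w).2.1), by norm_num,
        fun f => ?_⟩
      have e : Φ₁ = hvIso.trans (shift (-(toHV w).1) (-(toHV w).2.1)) := by
        rw [hΦ₁, toOrigin, if_neg hb]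
      rw [e]
      exact chart_trans h0 (shift _ _) (emb_pos_shift _ _) f
  have hw₁ : Φ₁ w = hvOrigin := by
    rw [hΦ₁, RelIso.trans_apply]
    exact toOrigin_apply_self (toHV w)
  have hu₁ : hvGraph.Adj hvOrigin (Φ₁ u) := by
    rw [← hw₁]
    exact (Φ₁.map_rel_iff).2 h.symm
  obtain ⟨α₁, β₁, hα₁, haff₁⟩ := h1
  -- Step 2: the rotation `ρ` by `2π/3` about `hvOrigin`, `(x₀, x₁, b) ↦ (-x₀ - x₁ - [b], x₀, b)`,
  -- an automorphism fixing `hvOrigin`, permuting its neighbours cyclically, affine on positions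
  let ρ : hvGraph ≃g hvGraph :=
    { toEquiv :=
        { toFun := fun x => (-x.1 - x.2.1 - bit x, x.1, x.2.2)
          invFun := fun x => (x.2.1, -x.1 - x.2.1 - bit x, x.2.2)
          left_inv := fun x => by
            obtain ⟨a, b, c⟩ := x
            cases c <;> simp [bit]
            ring
          right_inv := fun x => by
            obtain ⟨a, b, c⟩ := x
            cases c <;> simp [bit] <;> ring }
      map_rel_iff' := by
        rintro ⟨x, y, c⟩ ⟨x', y', c'⟩
        cases c <;> cases c' <;> simp [hvGraph_adj, AdjRel, bit] <;> omega }
  have hρ : ∀ x : HV, ρ x = (-x.1 - x.2.1 - bit x, x.1, x.2.2) := fun x => rfl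
  have hρO : ρ hvOrigin = hvOrigin := by rw [hρ]; rfl
  have hρ0 : ρ (0, 0, true) = (-1, 0, true) := by rw [hρ]; rfl
  have hρ1 : ρ (-1, 0, true) = wOut := by rw [hρ]; rfl
  have hρaff : ∀ x : HV, emb (pos (ρ x)) = omg ^ 2 * emb (pos x) + emb (3, 0) := by
    intro x
    have hp : pos (ρ x) = rot2 (pos x) + (3, 0) := by
      rw [hρ]
      obtain ⟨a, b, c⟩ := x
      cases c <;> simp [pos, rot2, bit] <;> ring
    rw [hp, emb_add, emb_rot2, mul_comm]
  have hω : omg ^ 2 ≠ 0 := pow_ne_zero _ omg_ne_zero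
  -- Step 3: rotate the image of `u` to `wOut`
  have hcases : Φ₁ u = (0, 0, true) ∨ Φ₁ u = (-1, 0, true) ∨ Φ₁ u = wOut := by
    have := (hvGraph_adj_iff_mem_nbrs _ _).1 hu₁
    simpa [hvOrigin, nbrs, wOut] using this
  rcases hcases with e | e | e
  · refine ⟨(Φ₁.trans ρ).trans ρ, omg ^ 2 * (omg ^ 2 * α₁),
      omg ^ 2 * (omg ^ 2 * β₁ + emb (3, 0)) + emb (3, 0), mul_ne_zero hω (mul_ne_zero hω hα₁),
      ?_, ?_, fun f => chart_trans (chart_trans haff₁ ρ hρaff) ρ hρaff f⟩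
    · rw [RelIso.trans_apply, RelIso.trans_apply, e, hρ0, hρ1]
    · rw [RelIso.trans_apply, RelIso.trans_apply, hw₁, hρO, hρO]
  · refine ⟨Φ₁.trans ρ, omg ^ 2 * α₁, omg ^ 2 * β₁ + emb (3, 0), mul_ne_zero hω hα₁, ?_, ?_,
      chart_trans haff₁ ρ hρaff⟩
    · rw [RelIso.trans_apply, e, hρ1]
    · rw [RelIso.trans_apply, hw₁, hρO]
  · exact ⟨Φ₁, α₁, β₁, hα₁, e, hw₁, haff₁⟩

/-! ### Geometric turning versus lattice turns -/

/-- The turning angle of a polyline is invariant under complex-affine maps `z ↦ α z + β`,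
`α ≠ 0`. [folklore] -/
theorem turning_affine {α : ℂ} (hα : α ≠ 0) (β z₁ z₂ z₃ : ℂ) :
    turning (α * z₁ + β) (α * z₂ + β) (α * z₃ + β) = turning z₁ z₂ z₃ := by
  unfold turning
  rw [show α * z₃ + β - (α * z₂ + β) = α * (z₃ - z₂) by ring,
    show α * z₂ + β - (α * z₁ + β) = α * (z₂ - z₁) by ring, mul_div_mul_left _ _ hα]

/-- Moving the first point of a polyline along its first segment (towards the second point, by a
positive factor) does not change the first turning angle. [folklore] -/
theorem turning_left_ray {t : ℝ} (ht : 0 < t) (z₁ z₂ z₃ : ℂ) :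
    turning (z₂ + t * (z₁ - z₂)) z₂ z₃ = turning z₁ z₂ z₃ := by
  unfold turning
  rw [show z₂ - (z₂ + t * (z₁ - z₂)) = (t : ℂ) * (z₂ - z₁) by ring, div_mul_eq_div_div,
    div_eq_inv_mul (z₃ - z₂), mul_div_assoc, ← Complex.ofReal_inv,
    Complex.arg_real_mul _ (inv_pos.2 ht)]

/-- Moving the last point of a polyline along its last segment (away from the middle point, by a
positive factor) does not change the last turning angle. [folklore] -/
theorem turning_right_ray {t : ℝ} (ht : 0 < t) (z₁ z₂ z₃ : ℂ) :
    turning z₁ z₂ (z₂ + t * (z₃ - z₂)) = turning z₁ z₂ z₃ := by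
  unfold turning
  rw [show z₂ + t * (z₃ - z₂) - z₂ = t * (z₃ - z₂) by ring, mul_div_assoc,
    Complex.arg_real_mul _ ht]

/-- **The lattice turn is the geometric turning angle**: along a two-step path `u → v → w` of the
embedded honeycomb lattice (no backtracking) the direction rotates by `(π/3) · turn u v w`.
[cite: DuminilCopinSmirnov2012, §2 (winding = total rotation of the direction)] -/
theorem turning_emb_pos {u v w : HV} (huv : hvGraph.Adj u v) (hvw : hvGraph.Adj v w)
    (huw : u ≠ w) :
    turning (emb (pos u)) (emb (pos v)) (emb (pos w)) = (Real.pi / 3) * turn u v w := by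
  rw [← toReal_argDiff_edir huv hvw huw, turning,
    show emb (pos w) - emb (pos v) = edir v w by rw [edir, emb_sub],
    show emb (pos v) - emb (pos u) = edir u v by rw [edir, emb_sub],
    ← Complex.arg_div_coe_angle (edir_ne_zero hvw) (edir_ne_zero huv),
    Complex.arg_coe_angle_toReal_eq_arg]

/-- **The geometric winding of an embedded lattice path without backtracking is
`(π/3) · pturn`.** [cite: DuminilCopinSmirnov2012, §2 (winding = total rotation of the
direction)] -/
theorem winding_map_emb_pos : ∀ (P : List HV), P.IsChain hvGraph.Adj →
    (∀ (i : ℕ) (hi : i + 2 < P.length), P[i] ≠ P[i + 2]'hi) →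
    Literature.Probability.LatticeModels.winding (P.map fun x => emb (pos x)) =
      (Real.pi / 3) * pturn P
  | [], _, _ => by simp
  | [_], _, _ => by simp
  | [_, _], _, _ => by simp
  | u :: v :: w :: L, hc, hb => by
    have huv : hvGraph.Adj u v := (List.isChain_cons_cons.1 hc).1
    have hc' : (v :: w :: L).IsChain hvGraph.Adj := (List.isChain_cons_cons.1 hc).2
    have hvw : hvGraph.Adj v w := (List.isChain_cons_cons.1 hc').1
    have huw : u ≠ w := hb 0 (by simp)
    have ih := winding_map_emb_pos (v :: w :: L) hc' fun i hi => by
      have := hb (i + 1) (by simpa using hi)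
      simpa using this
    simp only [List.map_cons] at ih ⊢
    rw [winding_cons_cons_cons, ih, turning_emb_pos huv hvw huw, pturn_cons₃]
    push_cast
    ring

end HV

end Literature.Probability.RandomPlanarGeometry.SAW
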